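import Summits.CriticalPhenomena.PercolationContinuityZ3.Theorems.PercNearOneGluingNoHeavyPcintMemAutomaton
import Literature.Probability.RandomPlanarGeometry.SAWMemoryFourUpperBound
import HarnessLib

/-!
# CriticalPhenomena/PercolationContinuityZ3 — Theorems/PercNearOneGluingNoHeavyPcintMemoryTailLaw.lean: STRUCTURE CONJ **C1′** of the pcint lane (the MEMORY-TAIL LAW), TYPED

HONEST FRAMING: a law about the RATE at which finite-memory walk counting converges to the self-avoiding-walk
connective constant; a numerical law with a physical mechanism, pre-registered and scored; NOT a theorem and not
used by any certified interval of the lane.  The certified `p_c` cells live in `../PercolationContinuityZ3/Theorems/`.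

Lane prim-pcint (paper-2 track (iii): certified intervals for `p_c(ℤ^d)`), coordinator STANDING RULE 2026-08-22
«NUMERICS ⇒ STRUCTURE ⇒ CONJECTURE» item (5): a conjecture that survived ≥ 3 pre-registered predictions is typed as a
Lean `Prop` with its evidence ledger (the gate has no `Conjectures/` target under this summit, so the file sits with the lane's other `Pcint` files; namespace `…Theorems.Pcint.MemoryTail`).  Statement of record: run/shared/lean/prim/pcint/STRUCTURE.md
v0.2 §1 (row MEMORY-TAIL LAW) / §2 (C1′); write-up run/shared/lean/prim/pcint/prim-pcint-2/gen12/README.md (prim-pcint-2 gen 12).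

THE OBJECT.  `c_{n,τ}` = number of `n`-step nearest-neighbour walks on `ℤ^d` from `0` with `w(i) ≠ w(j)` whenever
`0 < |i − j| ≤ τ` (Madras–Slade 1993, §1.2, (1.2.12)); `μ_τ(d) = lim c_{n,τ}^{1/n}` exists by submultiplicativity and
decreases to the connective constant `μ(d)` (MS Lemma 1.2.3).  Here: `memCount d τ n` (over the tree's step words and
the tree's `IsMem`), `memGrowth d τ := ⨅ₙ (memCount d τ (n+1))^{1/(n+1)}` (the infimum form, as the tree's
`connectiveConstant`).  PROVED below (sanity, kernel-checked, no `sorry`): `count ≤ memCount ≤ (2d)^n`, `memCount`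
antitone in `τ`, `connectiveConstant d ≤ memGrowth d τ ≤ 2d`, `memGrowth` antitone in `τ`.

THE LAW (C1′).  With `q_τ = 1/μ_τ`, `δ_τ = q_τ − q_{τ−2}`:  `δ_τ ≍ C_d τ^{−θ_d}`, **`θ_d = max(2, d/2)`** (`d = 4`: up to a
slowly varying factor), i.e. `ln(μ_τ/μ) ≃ κ_d/τ` for `d = 2, 3` and `≍ τ^{1−d/2}` for `d ≥ 5`.  MECHANISM (blob /
crossover argument): a memory-`τ` walk is a random walk of self-avoiding blobs of `τ` monomers; `ln(μ_τ/μ)` is the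
free-energy cost per step of forbidding the loops longer than `τ`; below the upper critical dimension 4 consecutive
blobs intersect with probability bounded below, so the cost is `O(1)` PER BLOB, `κ_d/τ` per step (`θ = 2`); above it
blobs are mutually transparent and the expected number of intersections of a blob with all later ones is `≍ τ^{2−d/2}`
(`θ = d/2`); `d = 4` is marginal.  PRINT: Pönitz–Tittmann 2000 (Electron. J. Combin. 7, R21) Table 2 tabulates
`μ(d,k)` without a rate; Madras–Slade Lemma 6.8.6 proves only `z_τ − z_c = O(τ^{−ε})`, `ε < min{(d−4)/2, 1}`, `d > 4`;
the printed analogue on the lower-bound side is Jensen 2004 (J. Phys. A 37; cond-mat/0409381): truncated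
irreducible-bridge bounds obey `μ − μ(n) ∼ a/n` in `d = 2`.

EVIDENCE LEDGER (engine `prim-pcint-2/gen12/memmu.c` = the lane's dangerous-set automaton `mstep` without bookkeeping,
validated on every printed / lane value: PT2000 Table 2 to its 4 decimals, Fisher–Sykes roots, the lane's two-engine
step-0 values `μ_16(3)`, `μ_18(3)`, `μ_14(4)` to 1e-10; growth constants by Collatz–Wielandt-bracketed power iteration;
exact limits `μ(ℤ²) = 2.63815853032790` (Jacobsen–Scullard–Guttmann 2016), `μ(ℤ³) = 4.684039931` (Clisby 2013),
`μ(ℤ⁴,ℤ⁵,ℤ⁶) = 6.774043 / 8.838544 / 10.878094` (Clisby–Liang–Slade 2007); tables in gen12/DATA.txt):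
the tail statistic `T_τ/δ_τ = (1/μ − q_τ)/(q_τ − q_{τ−2})`, which is CONSTANT under a geometric law and LINEAR with slope
`1/(θ−1)` per rung under a power law, reads
 • `d = 2` (τ = 10..24, classes up to 71 279 966, kit j179698): 4.585 / 5.573 / 6.577 / 7.578 / 8.577 / 9.577 / 10.576 /
   11.575 — per-rung increments 0.988, 1.004, 1.001, 1.000, 1.000, 0.999, 0.999, 0.999 ⇒ `θ_2 = 2.001`;
 • `d = 3` (τ = 10..18; τ16 kit j179381, τ18 = lane step-0 two-engine value): 4.264 / 5.240 / 6.221 / 7.204 / 8.188 —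
   increments 0.975, 0.981, 0.983, 0.984 ⇒ `θ_3 = 2.02 → 2`; `κ_3(τ) = τ ln(μ_τ/μ) = 0.1622 / 0.1627 / 0.1630` (τ = 14/16/18);
 • `d = 4` (τ ≤ 14): increments 0.834, 0.844, 0.846 ⇒ `θ_eff = 2.18` (marginal, slowly varying);
 • `d = 5` (τ ≤ 14, kit j179381): 0.648, 0.656, 0.661 ⇒ `θ_5 = 2.51`;  `d = 6`: 0.524, 0.518, 0.516 ⇒ `θ_6 = 2.94 → 3`.
PRE-REGISTERED (files sealed with sha256 in run/shared/lean/prim/pcint/predictions/ and gate-timestamped as evidence on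
stmt-CriticalPhenomena-4575 BEFORE their runs): P4 (2026-08-23T01:37Z, bb1826d0…; power law vs geometric on `d = 3`,
primary item `T_16/δ_16 ∈ [4.6, 7.6]` → 7.204 HIT, geometric band [2.1, 3.6] excluded; 8/9 secondaries HIT), P5 (01:43Z,
db0558d6…; next-rung ratios: bond `d = 3` r(16) = 0.7583 ∈ [0.7535, 0.7636], r(18) = 0.7841 ∈ [0.7790, 0.7901], `d = 4, 5, 6`
r(14) HIT — 7/7 bond items; neighbour-avoiding `d = 3` bands MISS ×3 by 0.01, diagnosed as negative N4), P6 (01:55Z,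
1112960b…, sealed before ANY `d = 2` run, hypothesis 'θ_d = max(2, d/2)'): `θ_2 = 2.001` HIT ×2.  Superseded law: C1a
('geometric, r ≈ 0.70', gen 11) = negative N3 of STRUCTURE.md §4.
SCOPE (honest): a METHOD-side law (how fast memory-τ counting bounds converge); its lane consequence is the re-cut of
the saturation values of the bookkeeping columns (bond ℤ³ B3m `p*(∞) = 0.2294 ± 0.0007`, site ℤ³ B2d `0.2628 ± 0.0006`,
both far below `p_c`), which are extrapolations, not certified numbers.  Nothing here is used by a certified cell.

Change log: 2026-08-23 prim-pcint-2 gen 12 (prover-prim-pcint-2-g12-0): v1.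
-/

noncomputable section

open Filter Topology
open Literature.Probability.LatticeModels Literature.Probability.Percolation
open Literature.Probability.RandomPlanarGeometry.SAW.Zd
open Summit.CriticalPhenomena.PercolationContinuityZ3.Theorems.Pcint (IsMem isMem_of_isSAW)

namespace Summit.CriticalPhenomena.PercolationContinuityZ3.Theorems.Pcint.MemoryTail

variable {d : ℕ}

open Classical in
/-- The memory-`τ` step words of length `n` on `ℤ^d` (`w(i) ≠ w(j)` for `0 < j − i ≤ τ`; Madras–Slade's `c_{n,τ}` counts
them). [cite: MadrasSlade1993, §1.2 (1.2.12) p. 10] -/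
def memWords (d τ n : ℕ) : Finset (Fin n → Fin d × Bool) :=
  Finset.univ.filter fun w => IsMem τ w

/-- `c_{n,τ}(d)`, the number of `n`-step memory-`τ` walks from the origin of `ℤ^d`. [cite: MadrasSlade1993, §1.2 (1.2.12) p. 10] -/
def memCount (d τ n : ℕ) : ℕ := (memWords d τ n).card

open Classical in
/-- Membership in `memWords`. [folklore] -/
@[simp] theorem mem_memWords {τ n : ℕ} {w : Fin n → Fin d × Bool} : w ∈ memWords d τ n ↔ IsMem τ w := by
  simp [memWords]

/-- Self-avoiding words have every finite memory: `sawWords ⊆ memWords`. [cite: MadrasSlade1993, §1.2 (1.2.13) p. 11] -/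
theorem sawWords_subset_memWords (d τ n : ℕ) : sawWords d n ⊆ memWords d τ n := by
  intro w hw
  rw [mem_sawWords] at hw
  exact mem_memWords.2 (isMem_of_isSAW τ hw)

/-- A longer memory is a stronger constraint: `memWords τ₂ ⊆ memWords τ₁` for `τ₁ ≤ τ₂`. [cite: MadrasSlade1993, §1.2, proof of Lemma 1.2.3] -/
theorem memWords_subset_of_le {τ₁ τ₂ : ℕ} (h : τ₁ ≤ τ₂) (d n : ℕ) : memWords d τ₂ n ⊆ memWords d τ₁ n := by
  intro w hw
  rw [mem_memWords] at hw ⊢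
  intro i j hj hij hτ
  exact hw i j hj hij (by omega)

/-- `c_n ≤ c_{n,τ}`. [cite: MadrasSlade1993, §1.2 (1.2.13) p. 11] -/
theorem count_le_memCount [NeZero d] (τ n : ℕ) : count d n ≤ memCount d τ n :=
  (count_le_card_sawWords d n).trans (Finset.card_le_card (sawWords_subset_memWords d τ n))

/-- `c_{n,τ₂} ≤ c_{n,τ₁}` for `τ₁ ≤ τ₂`. [cite: MadrasSlade1993, §1.2, proof of Lemma 1.2.3] -/
theorem memCount_le_of_le {τ₁ τ₂ : ℕ} (h : τ₁ ≤ τ₂) (d n : ℕ) : memCount d τ₂ n ≤ memCount d τ₁ n :=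
  Finset.card_le_card (memWords_subset_of_le h d n)

/-- `c_{n,τ} ≤ (2d)^n` (all step words). [folklore] -/
theorem memCount_le_pow (d τ n : ℕ) : memCount d τ n ≤ (2 * d) ^ n := by
  classical
  calc memCount d τ n ≤ (Finset.univ : Finset (Fin n → Fin d × Bool)).card := Finset.card_le_card (Finset.filter_subset _ _)
    _ = (2 * d) ^ n := by simp [Finset.card_univ, Fintype.card_prod, mul_comm]

/-- **`μ_τ(d)`**, the growth constant of memory-`τ` walks, in the infimum form `⨅ₙ c_{n+1,τ}^{1/(n+1)}` (equal to
Madras–Slade's `lim c_{n,τ}^{1/n}` by submultiplicativity; the infimum form matches the tree's `connectiveConstant`).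
[cite: MadrasSlade1993, §1.2 (1.2.12) p. 10] -/
def memGrowth (d τ : ℕ) : ℝ :=
  ⨅ n : ℕ, (memCount d τ (n + 1) : ℝ) ^ (1 / ((n : ℝ) + 1))

/-- The terms `c_{n+1,τ}^{1/(n+1)}` are bounded below (by `0`). [folklore] -/
theorem bddBelow_memRpow (d τ : ℕ) :
    BddBelow (Set.range fun n : ℕ => (memCount d τ (n + 1) : ℝ) ^ (1 / ((n : ℝ) + 1))) :=
  ⟨0, by rintro _ ⟨m, rfl⟩; exact Real.rpow_nonneg (Nat.cast_nonneg _) _⟩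

/-- `μ_τ(d) ≥ 0`. [folklore] -/
theorem memGrowth_nonneg (d τ : ℕ) : 0 ≤ memGrowth d τ :=
  Real.iInf_nonneg fun _ => Real.rpow_nonneg (Nat.cast_nonneg _) _

/-- **`μ(d) ≤ μ_τ(d)`** for every memory `τ`: finite-memory counting bounds the connective constant from above.
[cite: MadrasSlade1993, §1.2, Lemma 1.2.3 and (1.2.13) p. 11] -/
theorem connectiveConstant_le_memGrowth [NeZero d] (τ : ℕ) : connectiveConstant d ≤ memGrowth d τ := by
  refine le_ciInf fun n => ?_
  have h1 : connectiveConstant d ≤ (count d (n + 1) : ℝ) ^ (1 / ((n : ℝ) + 1)) := by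
    have := connectiveConstant_le_rpow (d := d) (n := n + 1) (by omega)
    simpa [Nat.cast_succ] using this
  refine h1.trans (Real.rpow_le_rpow (Nat.cast_nonneg _) ?_ (by positivity))
  exact_mod_cast count_le_memCount τ (n + 1)

/-- `μ_{τ₂}(d) ≤ μ_{τ₁}(d)` for `τ₁ ≤ τ₂`: the memory bounds improve monotonically. [cite: MadrasSlade1993, §1.2, proof of Lemma 1.2.3] -/
theorem memGrowth_antitone {τ₁ τ₂ : ℕ} (h : τ₁ ≤ τ₂) (d : ℕ) : memGrowth d τ₂ ≤ memGrowth d τ₁ := by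
  refine le_ciInf fun n => (ciInf_le (bddBelow_memRpow d τ₂) n).trans ?_
  exact Real.rpow_le_rpow (Nat.cast_nonneg _) (by exact_mod_cast memCount_le_of_le h d (n + 1)) (by positivity)

/-- `μ_τ(d) ≤ 2d` (the `n = 1` term of the infimum). [folklore] -/
theorem memGrowth_le (d τ : ℕ) : memGrowth d τ ≤ 2 * d := by
  refine (ciInf_le (bddBelow_memRpow d τ) 0).trans ?_
  have h : (memCount d τ 1 : ℝ) ≤ 2 * d := by exact_mod_cast (memCount_le_pow d τ 1).trans_eq (pow_one _)
  simpa using h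

/-- The quantity the law is about: `L_d(τ) := ln(μ_τ(d)/μ(d)) ≥ 0`, the per-step free-energy cost of forbidding the loops
longer than `τ`. [cite: MadrasSlade1993, §1.2, Lemma 1.2.3] -/
def logRatio (d τ : ℕ) : ℝ := Real.log (memGrowth d τ / connectiveConstant d)

/-- **C1′ below the upper critical dimension (`d = 2, 3`): `τ · ln(μ_τ/μ) → κ_d ∈ (0, ∞)`** along even `τ` (odd memory
adds nothing on the bipartite lattice), i.e. `μ_τ − μ ≃ μ κ_d/τ` and the threshold increments decay like `τ^{−2}`.
Evidence: `d = 2` slope of the tail statistic 1.000 ± 0.001 over τ = 14..24 (`θ_2 = 2.001`), `κ_2(τ) = 0.332 / 0.334 / 0.336`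
(τ = 14/16/18); `d = 3` slope 0.975 → 0.984, `κ_3(τ) = 0.1622 / 0.1627 / 0.1630`; pre-registered P4 (primary HIT), P5 (bond
items 7/7 HIT), P6 (sealed before any `d = 2` run, HIT ×2); mechanism = O(1) free energy per memory blob (see the file
docstring).  STRUCTURE CONJ C1′ (prim-pcint-2 gen 12, 2026-08-23; STRUCTURE.md v0.2 §2; not kernel-checked). -/
@[conjecture] def lawLow : Prop :=
  ∀ d : ℕ, d = 2 ∨ d = 3 →
    ∃ κ : ℝ, 0 < κ ∧ Tendsto (fun m : ℕ => (2 * (m : ℝ)) * logRatio d (2 * m)) atTop (𝓝 κ)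

/-- **C1′ above the upper critical dimension (`d ≥ 5`): `τ^{d/2−1} · ln(μ_τ/μ) → κ_d ∈ (0, ∞)`** along even `τ`, i.e. the
threshold increments decay like `τ^{−d/2}` (Gaussian, mutually transparent blobs).  Evidence: tail-statistic slopes
0.661 (`d = 5`, `θ = 2.51`) and 0.516 (`d = 6`, `θ = 2.94`, still drifting toward 3) at τ ≤ 14 against the Clisby–Liang–Slade
constants; pre-registered P5d HIT ×2; consistent with (and sharper than) Madras–Slade Lemma 6.8.6.  STRUCTURE CONJ C1′
(prim-pcint-2 gen 12, 2026-08-23; STRUCTURE.md v0.2 §2; not kernel-checked). -/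
@[conjecture] def lawHigh : Prop :=
  ∀ d : ℕ, 5 ≤ d →
    ∃ κ : ℝ, 0 < κ ∧ Tendsto (fun m : ℕ => (2 * (m : ℝ)) ^ ((d : ℝ) / 2 - 1) * logRatio d (2 * m)) atTop (𝓝 κ)

/-- **C1′ at the marginal dimension `d = 4`: `ln(μ_τ/μ)` decays like `τ^{−1}` up to sub-power (logarithmic) factors** —
for every `ε > 0`, `τ^{1−ε} ln(μ_τ/μ) → 0` and `τ^{1+ε} ln(μ_τ/μ) → ∞`.  Evidence (weakest of the three): tail-statistic
slopes 0.834 / 0.844 / 0.846 at τ = 10/12/14 (effective `θ = 2.18`, creeping toward 2), `κ_4(τ) = τ ln(μ_τ/μ) = 0.0645 /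
0.0630 / 0.0617`; pre-registered P4c/P5c HIT (τ16 item pending at filing, kit j179911).  STRUCTURE CONJ C1′ (prim-pcint-2
gen 12, 2026-08-23; STRUCTURE.md v0.2 §2; not kernel-checked). -/
@[conjecture] def lawFour : Prop :=
  ∀ ε : ℝ, 0 < ε →
    Tendsto (fun m : ℕ => (2 * (m : ℝ)) ^ (1 - ε) * logRatio 4 (2 * m)) atTop (𝓝 0) ∧
    Tendsto (fun m : ℕ => (2 * (m : ℝ)) ^ (1 + ε) * logRatio 4 (2 * m)) atTop atTop

/-- Bookkeeping (no mathematics beyond the proved sanity facts): `L_d(τ) ≥ 0` whenever `μ(d) > 0`, so the limits `κ_d`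
of `lawLow` / `lawHigh`, if they exist, are limits of non-negative sequences. [folklore] -/
theorem logRatio_nonneg [NeZero d] {τ : ℕ} (hμ : 0 < connectiveConstant d) : 0 ≤ logRatio d τ :=
  Real.log_nonneg ((one_le_div hμ).2 (connectiveConstant_le_memGrowth τ))

end Summit.CriticalPhenomena.PercolationContinuityZ3.Theorems.Pcint.MemoryTail
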